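import Literature.AlgebraicGeometry.HodgeTheory.NoTypeIVFactorProducts
import Literature.AlgebraicGeometry.Motives.AbelianVarietyEndAlgebraSemisimple
import Literature.AlgebraicGeometry.Motives.AbelianVarietyIsotypicDecomposition
import Literature.RingTheory.Idempotents.CornerRingCentre
import HarnessLib

/-!
# The centre of `End⁰(A × B)` maps ONTO the centres of `End⁰(A)` and `End⁰(B)`; hence «no simple factor of
# type IV» descends to factors: `HasNoTypeIVFactor (A × B) ↔ HasNoTypeIVFactor A ∧ HasNoTypeIVFactor B`
# (Mumford §19 Cor. 2; Moonen–Zarhin 1999 §1), powers, finite biproducts, isogenous varieties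

Family `hodge`, layer `Literature/AlgebraicGeometry/HodgeTheory`; THEOREMS ONLY — no definition, no named fact, no
`sorry` (D-0026, net debt 0). Lane `lit-hodgefound` (Track 2 foundations library), prover seat `lit-hodgefound-p21`,
generation 29, FILE 2 of row g29-#1/#2 (FILE 1 = `Literature/RingTheory/Idempotents/CornerRingCentre`: the centre of
a corner ring `eMe` of a semisimple ring `M` is `e · Cen M`). Sequel of `NoTypeIVFactorProducts` (its docstring:
«The converse `HasNoTypeIVFactor (A.prod B) → HasNoTypeIVFactor A` (true in print: the simple factors of `A` are
among those of `A × B`) is NOT proved here — it needs Poincaré reducibility inside `End⁰(A × B)`, not the corner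
calculus») and of `NoTypeIVFactorOrthogonalProducts` (the converse for `Hom(A, B) = 0 = Hom(B, A)` only).

PUBLISHED STATEMENTS. Mumford, *Abelian Varieties*, §19 Cor. 2 (p. 174): for `X` isogenous to
`X₁^{n₁} × ⋯ × X_k^{n_k}`, `Xᵢ` simple and pairwise non-isogenous, `End⁰(X) = ⊕ᵢ M_{nᵢ}(Dᵢ)`, `Dᵢ = End⁰(Xᵢ)`; in
particular `End⁰(X)` is semisimple (Cor. 2 of Thm. 1, the tree's
`AbelianVariety.isSemisimpleRing_endAlgebra_of_isAlgClosed`) and its centre is `⊕ᵢ Z(Dᵢ)` over the simple factors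
OCCURRING in `X`. Moonen–Zarhin, *Hodge classes on abelian varieties of low dimension*, Math. Ann. 315 (1999) §1:
a simple `X` is of type IV iff `F = Cent(D)` is a CM field, of types I–III iff `F` is totally real; «no factors of
Type 4» is a condition on the simple factors, so it holds for `X₁ × X₂` iff it holds for `X₁` and for `X₂` (the
simple factors of `X₁ × X₂` are those of `X₁` together with those of `X₂`), and Thm. (3.2) uses it in this form.

THE TREE'S RENDERING AND THE PROOF. `HasNoTypeIVFactor A` (`HodgeGroupProductCMFactor`): every central element of
`End⁰(A) = A.endAlgebra` is killed by a non-zero rational polynomial with only real roots. For `M = End⁰(A × B)`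
and the idempotent `e = diag(1, 0)` (`inlAlg A B 1`) the corner `eMe` is `diag(End⁰(A), 0)`
(`inlAlg_one_mul_mul_inlAlg_one`), so for a central `x ∈ End⁰(A)` the element `c = diag(x, 0)` is central in the
corner; `M` is semisimple (Poincaré–Mumford), hence by FILE 1
(`CornerCentre.exists_central_mul_eq_of_isSemisimpleRing`) `c = e z` for a central `z ∈ M`, and `corner₁ z = x`:
**the corner map `Z(End⁰(A × B)) → Z(End⁰ A)` is onto** (§1). A polynomial killing `z` kills its block-diagonal
corners (`eq_prodEndAlgebraHom_of_mem_center`, `prodEndAlgebraHom` an injective algebra map), which gives §2.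

MAIN RESULTS (all proved):
* §1 `NoTypeIVFactorProducts.exists_mem_center_fstAlg_eq` / `…sndAlg_eq` — every central element of `End⁰(A)`
  (`End⁰(B)`) is the corner of a central element of `End⁰(A × B)`;
* §2 **`HasNoTypeIVFactor.of_prod_left` / `.of_prod_right`, `hasNoTypeIVFactor_prod_iff`**
  (`HasNoTypeIVFactor (A.prod B) ↔ HasNoTypeIVFactor A ∧ HasNoTypeIVFactor B`, NO hypothesis on `Hom(A, B)`),
  `hasNoTypeIVFactor_powSucc_iff`, `HasNoTypeIVFactor.of_powSucc`, `hasNoTypeIVFactor_iff_of_isIsogenous_prod`,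
  `HasNoTypeIVFactor.of_isIsogenous_prod_left/right`;
* §3 finite biproducts: `AbelianVariety.nonempty_iso_biproduct_fin_one`, `AbelianVariety.nonempty_iso_biproduct_fin_succ`
  (`⨁_{i ≤ n+1} Bᵢ ≅ (⨁_{i ≤ n} Bᵢ) × B_{n+1}` on the tree's `AbelianVariety.prod`), **`hasNoTypeIVFactor_biproduct_iff`**
  (`HasNoTypeIVFactor (⨁ᵢ Bᵢ) ↔ ∀ i, HasNoTypeIVFactor (Bᵢ)`, `Fin (n+1)`-indexed) and the `Fintype`-indexed
  `hasNoTypeIVFactor_biproduct_iff_of_nonempty`;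
* §4 **`hasNoTypeIVFactor_iff_forall_of_isIsogenous_biproduct_powers`**: for `X ∼ ⨁_q ⨁_{Fin (n_q+1)} B_q` (the shape
  of the tree's isotypic decomposition `AbelianVariety.exists_isIsogenous_biproduct_powers`),
  `HasNoTypeIVFactor X ↔ ∀ q, HasNoTypeIVFactor (B_q)` — «no factor of type IV» is a condition on the simple factors.

## References

* [MumfordAV1970] D. Mumford, *Abelian Varieties*, §19 Thm. 1, Cor. 1, Cor. 2 (p. 174) and Cor. 2 of Thm. 1.
  [cite: MumfordAV1970, §19 Cor. 2 (p. 174)]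
* [MoonenZarhin1999LowDim] B. Moonen, Yu. Zarhin, Math. Ann. 315 (1999) 711–733, §1 and Thm. (3.2).
  [cite: MoonenZarhin1999LowDim, §1 and Thm. (3.2)]
* [Lange2023AbelianVarietiesC] H. Lange, *Abelian Varieties over the Complex Numbers* (2023), Thm. 2.4.25, Cor. 2.4.26.
  [cite: Lange2023AbelianVarietiesC, Thm. 2.4.25 and Cor. 2.4.26]
* [AndersonFuller1992] F. W. Anderson, K. R. Fuller, *Rings and Categories of Modules*, §21 Prop. 21.10 (the centre
  under Morita equivalence; FILE 1).
-/

noncomputable section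

open CategoryTheory CategoryTheory.Limits Polynomial

namespace Literature.AlgebraicGeometry.HodgeTheory

open Literature.AlgebraicGeometry.Motives
open Literature.AlgebraicGeometry.Milne1999.CMTypeProducts
open Literature.RingTheory.Idempotents

namespace NoTypeIVFactorProducts

variable {A B : AbelianVariety ℂ}

/-! ### §1 The corner maps `Z(End⁰(A × B)) → Z(End⁰ A)`, `Z(End⁰ B)` are surjective -/

/-- `diag(1, 0)` is an idempotent of `End⁰(A × B)`. [cite: MumfordAV1970, §19 Cor. 2 (p. 174)] -/
theorem isIdempotentElem_inlAlg_one : IsIdempotentElem (inlAlg A B 1) := by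
  show inlAlg A B 1 * inlAlg A B 1 = inlAlg A B 1
  rw [← inlAlg_mul, mul_one]

/-- `diag(0, 1)` is an idempotent of `End⁰(A × B)`. [cite: MumfordAV1970, §19 Cor. 2 (p. 174)] -/
theorem isIdempotentElem_inrAlg_one : IsIdempotentElem (inrAlg A B 1) := by
  show inrAlg A B 1 * inrAlg A B 1 = inrAlg A B 1
  rw [← inrAlg_mul, mul_one]

/-- **The upper-left corner map `Z(End⁰(A × B)) → Z(End⁰(A))` is onto**: every central `x ∈ End⁰(A)` is
`corner₁ z` for a central `z ∈ End⁰(A × B)`. (`diag(x, 0)` is central in the corner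
`diag(1,0) · End⁰(A × B) · diag(1,0) = diag(End⁰ A, 0)`; `End⁰(A × B)` is semisimple by Poincaré–Mumford, so the
centre of the corner is `diag(1,0) · Z(End⁰(A × B))`, FILE 1.) In print: `Z(End⁰ X) = ⊕ Z(Dᵢ)` over the simple
factors of `X`, and the simple factors of `A` are among those of `A × B`.
[cite: MumfordAV1970, §19 Cor. 2 (p. 174)] [cite: AndersonFuller1992, §21 Prop. 21.10 and Exercise 21.6(3) (pp. 260–261)] -/
theorem exists_mem_center_fstAlg_eq {x : A.endAlgebra} (hx : x ∈ Subalgebra.center ℚ (A.endAlgebra)) :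
    ∃ z ∈ Subalgebra.center ℚ ((A.prod B).endAlgebra), fstAlg A B z = x := by
  haveI : IsSemisimpleRing ((A.prod B).endAlgebra) :=
    AbelianVariety.isSemisimpleRing_endAlgebra_of_isAlgClosed _
  have hx' : ∀ b : A.endAlgebra, b * x = x * b := Subalgebra.mem_center_iff.1 hx
  obtain ⟨z, hz, hez, -⟩ := CornerCentre.exists_central_mul_eq_of_isSemisimpleRing
    (e := inlAlg A B 1) (c := inlAlg A B x) isIdempotentElem_inlAlg_one
    (by rw [← inlAlg_mul, one_mul]) (by rw [← inlAlg_mul, mul_one])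
    (fun m => by
      rw [inlAlg_one_mul_mul_inlAlg_one, ← inlAlg_mul, ← inlAlg_mul]
      congr 1
      exact (hx' _).symm)
  refine ⟨z, Subalgebra.mem_center_iff.2 hz, ?_⟩
  rw [← one_mul (fstAlg A B z), ← fstAlg_inlAlg_mul, hez, fstAlg_inlAlg]

/-- **The lower-right corner map `Z(End⁰(A × B)) → Z(End⁰(B))` is onto.**
[cite: MumfordAV1970, §19 Cor. 2 (p. 174)] [cite: AndersonFuller1992, §21 Prop. 21.10 and Exercise 21.6(3) (pp. 260–261)] -/
theorem exists_mem_center_sndAlg_eq {y : B.endAlgebra} (hy : y ∈ Subalgebra.center ℚ (B.endAlgebra)) :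
    ∃ z ∈ Subalgebra.center ℚ ((A.prod B).endAlgebra), sndAlg A B z = y := by
  haveI : IsSemisimpleRing ((A.prod B).endAlgebra) :=
    AbelianVariety.isSemisimpleRing_endAlgebra_of_isAlgClosed _
  have hy' : ∀ b : B.endAlgebra, b * y = y * b := Subalgebra.mem_center_iff.1 hy
  obtain ⟨z, hz, hez, -⟩ := CornerCentre.exists_central_mul_eq_of_isSemisimpleRing
    (e := inrAlg A B 1) (c := inrAlg A B y) isIdempotentElem_inrAlg_one
    (by rw [← inrAlg_mul, one_mul]) (by rw [← inrAlg_mul, mul_one])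
    (fun m => by
      rw [inrAlg_one_mul_mul_inrAlg_one, ← inrAlg_mul, ← inrAlg_mul]
      congr 1
      exact (hy' _).symm)
  refine ⟨z, Subalgebra.mem_center_iff.2 hz, ?_⟩
  rw [← one_mul (sndAlg A B z), ← sndAlg_inrAlg_mul, hez, sndAlg_inrAlg]

/-- The corner pair `z ↦ (corner₁ z, corner₂ z)` maps `Z(End⁰(A × B))` into `Z(End⁰ A) × Z(End⁰ B)` with BOTH
projections surjective (it is injective by `center_ext`; it is onto iff `Hom(A, B) = 0 = Hom(B, A)` —
`NoTypeIVFactorOrthogonalProducts` — and for `B = A` its image is the diagonal).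
[cite: MumfordAV1970, §19 Cor. 2 (p. 174)] -/
theorem fstAlg_image_center_eq :
    fstAlg A B '' (Subalgebra.center ℚ ((A.prod B).endAlgebra) : Set ((A.prod B).endAlgebra)) =
      (Subalgebra.center ℚ (A.endAlgebra) : Set (A.endAlgebra)) := by
  ext x
  constructor
  · rintro ⟨z, hz, rfl⟩
    exact fstAlg_mem_center hz
  · intro hx
    obtain ⟨z, hz, hzx⟩ := exists_mem_center_fstAlg_eq (B := B) hx
    exact ⟨z, hz, hzx⟩

/-- The same for the lower-right corner. [cite: MumfordAV1970, §19 Cor. 2 (p. 174)] -/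
theorem sndAlg_image_center_eq :
    sndAlg A B '' (Subalgebra.center ℚ ((A.prod B).endAlgebra) : Set ((A.prod B).endAlgebra)) =
      (Subalgebra.center ℚ (B.endAlgebra) : Set (B.endAlgebra)) := by
  ext y
  constructor
  · rintro ⟨z, hz, rfl⟩
    exact sndAlg_mem_center hz
  · intro hy
    obtain ⟨z, hz, hzy⟩ := exists_mem_center_sndAlg_eq (A := A) hy
    exact ⟨z, hz, hzy⟩

/-- `aeval` on a pair, first component. [folklore] -/
private theorem fst_aeval_pair {S T : Type*} [Ring S] [Ring T] [Algebra ℚ S] [Algebra ℚ T] (a : S) (b : T)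
    (f : ℚ[X]) : (aeval (a, b) f).1 = aeval a f := by
  simpa using (aeval_algHom_apply (AlgHom.fst ℚ S T) (a, b) f).symm

/-- `aeval` on a pair, second component. [folklore] -/
private theorem snd_aeval_pair {S T : Type*} [Ring S] [Ring T] [Algebra ℚ S] [Algebra ℚ T] (a : S) (b : T)
    (f : ℚ[X]) : (aeval (a, b) f).2 = aeval b f := by
  simpa using (aeval_algHom_apply (AlgHom.snd ℚ S T) (a, b) f).symm

/-- A polynomial killing a central `z ∈ End⁰(A × B)` kills its corners (`z = diag(corner₁ z, corner₂ z)` and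
`diag` is an injective algebra homomorphism). [cite: MumfordAV1970, §19 Cor. 2 (p. 174)] -/
theorem aeval_fstAlg_eq_zero_of_mem_center {z : (A.prod B).endAlgebra}
    (hz : z ∈ Subalgebra.center ℚ ((A.prod B).endAlgebra)) {f : ℚ[X]} (hf : aeval z f = 0) :
    aeval (fstAlg A B z) f = 0 ∧ aeval (sndAlg A B z) f = 0 := by
  rw [eq_prodEndAlgebraHom_of_mem_center hz, aeval_algHom_apply] at hf
  have h0 : aeval (fstAlg A B z, sndAlg A B z) f = 0 :=
    prodEndAlgebraHom_injective (hf.trans (map_zero _).symm)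
  exact ⟨by rw [← fst_aeval_pair (fstAlg A B z) (sndAlg A B z) f, h0, Prod.fst_zero],
    by rw [← snd_aeval_pair (fstAlg A B z) (sndAlg A B z) f, h0, Prod.snd_zero]⟩

end NoTypeIVFactorProducts

open NoTypeIVFactorProducts

/-! ### §2 `HasNoTypeIVFactor` descends to the factors of a product -/

/-- **`HasNoTypeIVFactor (A × B) → HasNoTypeIVFactor A`** (no hypothesis on `Hom(A, B)`): a central `x ∈ End⁰(A)`
is the corner of a central `z ∈ End⁰(A × B)` (§1), and a real-rooted rational polynomial killing `z` kills `x`. In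
print: the simple factors of `A` are among those of `A × B`, so if none of the latter is of type IV, none of the
former is. [cite: MoonenZarhin1999LowDim, §1 and Thm. (3.2)] [cite: MumfordAV1970, §19 Cor. 2 (p. 174)] -/
theorem HasNoTypeIVFactor.of_prod_left {A B : AbelianVariety ℂ} (h : HasNoTypeIVFactor (A.prod B)) :
    HasNoTypeIVFactor A := by
  intro x hx
  obtain ⟨z, hz, hzx⟩ := exists_mem_center_fstAlg_eq (B := B) hx
  obtain ⟨f, hf0, hfz, hfr⟩ := h z hz
  refine ⟨f, hf0, ?_, hfr⟩
  rw [← hzx]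
  exact (aeval_fstAlg_eq_zero_of_mem_center hz hfz).1

/-- **`HasNoTypeIVFactor (A × B) → HasNoTypeIVFactor B`.** [cite: MoonenZarhin1999LowDim, §1 and Thm. (3.2)]
[cite: MumfordAV1970, §19 Cor. 2 (p. 174)] -/
theorem HasNoTypeIVFactor.of_prod_right {A B : AbelianVariety ℂ} (h : HasNoTypeIVFactor (A.prod B)) :
    HasNoTypeIVFactor B := by
  intro y hy
  obtain ⟨z, hz, hzy⟩ := exists_mem_center_sndAlg_eq (A := A) hy
  obtain ⟨f, hf0, hfz, hfr⟩ := h z hz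
  refine ⟨f, hf0, ?_, hfr⟩
  rw [← hzy]
  exact (aeval_fstAlg_eq_zero_of_mem_center hz hfz).2

/-- **«No factors of Type 4» holds for `X₁ × X₂` iff it holds for `X₁` and for `X₂`**:
`HasNoTypeIVFactor (A.prod B) ↔ HasNoTypeIVFactor A ∧ HasNoTypeIVFactor B` (the forward direction is this file,
the backward one the tree's `HasNoTypeIVFactor.prod`). [cite: MoonenZarhin1999LowDim, §1 and Thm. (3.2)]
[cite: MumfordAV1970, §19 Cor. 2 (p. 174)] -/
theorem hasNoTypeIVFactor_prod_iff {A B : AbelianVariety ℂ} :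
    HasNoTypeIVFactor (A.prod B) ↔ HasNoTypeIVFactor A ∧ HasNoTypeIVFactor B :=
  ⟨fun h => ⟨h.of_prod_left, h.of_prod_right⟩, fun h => h.1.prod h.2⟩

/-- **Powers: `HasNoTypeIVFactor (A^{N+1}) ↔ HasNoTypeIVFactor A`** (the tree had `→` from `A` to its powers only).
[cite: MoonenZarhin1999LowDim, §1 and Thm. (3.2)] [cite: Lange2023AbelianVarietiesC, Thm. 2.4.25 and Cor. 2.4.26] -/
theorem hasNoTypeIVFactor_powSucc_iff {A : AbelianVariety ℂ} : ∀ N : ℕ, HasNoTypeIVFactor (A.powSucc N) ↔ HasNoTypeIVFactor A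
  | 0 => Iff.rfl
  | N + 1 => by
    rw [AbelianVariety.powSucc_succ, hasNoTypeIVFactor_prod_iff, hasNoTypeIVFactor_powSucc_iff N, and_self_iff]

/-- `HasNoTypeIVFactor (A^{N+1}) → HasNoTypeIVFactor A`. [cite: MoonenZarhin1999LowDim, §1 and Thm. (3.2)] -/
theorem HasNoTypeIVFactor.of_powSucc {A : AbelianVariety ℂ} {N : ℕ} (h : HasNoTypeIVFactor (A.powSucc N)) :
    HasNoTypeIVFactor A :=
  (hasNoTypeIVFactor_powSucc_iff N).1 h

/-- **Up to isogeny: for `X ∼ A × B`, `HasNoTypeIVFactor X ↔ HasNoTypeIVFactor A ∧ HasNoTypeIVFactor B`**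
(`End⁰` is an isogeny invariant, `hasNoTypeIVFactor_iff_of_isIsogenous`). [cite: MoonenZarhin1999LowDim, §1 and Thm. (3.2)]
[cite: MumfordAV1970, §19 Cor. 2 (p. 174)] -/
theorem hasNoTypeIVFactor_iff_of_isIsogenous_prod {X A B : AbelianVariety ℂ} (hX : AbelianVariety.IsIsogenous X (A.prod B)) :
    HasNoTypeIVFactor X ↔ HasNoTypeIVFactor A ∧ HasNoTypeIVFactor B :=
  (hasNoTypeIVFactor_iff_of_isIsogenous hX).trans hasNoTypeIVFactor_prod_iff

/-- `X ∼ A × B` without type-IV factor ⟹ `A` without type-IV factor. [cite: MoonenZarhin1999LowDim, §1 and Thm. (3.2)] -/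
theorem HasNoTypeIVFactor.of_isIsogenous_prod_left {X A B : AbelianVariety ℂ} (h : HasNoTypeIVFactor X)
    (hX : AbelianVariety.IsIsogenous X (A.prod B)) : HasNoTypeIVFactor A :=
  ((hasNoTypeIVFactor_iff_of_isIsogenous_prod hX).1 h).1

/-- `X ∼ A × B` without type-IV factor ⟹ `B` without type-IV factor. [cite: MoonenZarhin1999LowDim, §1 and Thm. (3.2)] -/
theorem HasNoTypeIVFactor.of_isIsogenous_prod_right {X A B : AbelianVariety ℂ} (h : HasNoTypeIVFactor X)
    (hX : AbelianVariety.IsIsogenous X (A.prod B)) : HasNoTypeIVFactor B :=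
  ((hasNoTypeIVFactor_iff_of_isIsogenous_prod hX).1 h).2

/-- `HasNoTypeIVFactor (A^{M+1} × B^{N+1}) ↔ HasNoTypeIVFactor A ∧ HasNoTypeIVFactor B` — the shape of the binders of
the cell's product rows (`HasNoTypeIVFactor.powSucc_prod_powSucc` is the backward direction).
[cite: MoonenZarhin1999LowDim, §1 and Thm. (3.2)] -/
theorem hasNoTypeIVFactor_powSucc_prod_powSucc_iff {A B : AbelianVariety ℂ} (M N : ℕ) :
    HasNoTypeIVFactor ((A.powSucc M).prod (B.powSucc N)) ↔ HasNoTypeIVFactor A ∧ HasNoTypeIVFactor B := by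
  rw [hasNoTypeIVFactor_prod_iff, hasNoTypeIVFactor_powSucc_iff, hasNoTypeIVFactor_powSucc_iff]

end Literature.AlgebraicGeometry.HodgeTheory

/-! ### §3 Finite biproducts `⨁ᵢ Bᵢ` -/

namespace Literature.AlgebraicGeometry.Motives

namespace AbelianVariety

universe u

variable {K : Type u} [Field K]

/-- `⨁_{Fin 1} B ≅ B₀`. [cite: MumfordAV1970, §19 (Hom(C, A × B) = Hom(C, A) ⊕ Hom(C, B))] -/
theorem nonempty_iso_biproduct_fin_one (B : Fin 1 → AbelianVariety K) : Nonempty ((⨁ B) ≅ B 0) :=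
  ⟨Iso.mk (biproduct.π B 0) (biproduct.lift fun j => eqToHom (by rw [Subsingleton.elim j 0]))
    (biproduct.hom_ext _ _ fun j => by
      rw [Category.assoc, biproduct.lift_π, Category.id_comp]
      have hj : j = 0 := Subsingleton.elim j 0
      subst hj
      simp)
    (by rw [biproduct.lift_π]; simp)⟩

/-- **`⨁_{i ≤ n+1} Bᵢ ≅ (⨁_{i ≤ n} Bᵢ) × B_{n+1}`** on the tree's binary product `AbelianVariety.prod` (both sides are
products of the family; universal properties of the biproduct and of `prod`).
[cite: MumfordAV1970, §19 (Hom(C, A × B) = Hom(C, A) ⊕ Hom(C, B))] -/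
theorem nonempty_iso_biproduct_fin_succ {n : ℕ} (B : Fin (n + 2) → AbelianVariety K) :
    Nonempty ((⨁ B) ≅ (⨁ fun i : Fin (n + 1) => B i.castSucc).prod (B (Fin.last (n + 1)))) := by
  refine ⟨Iso.mk
    (prodLift (biproduct.lift fun i : Fin (n + 1) => biproduct.π B i.castSucc) (biproduct.π B (Fin.last (n + 1))))
    (biproduct.lift fun j => Fin.lastCases (snd _ _)
      (fun i : Fin (n + 1) => fst _ _ ≫ biproduct.π (fun i : Fin (n + 1) => B i.castSucc) i) j)
    ?_ ?_⟩
  · refine biproduct.hom_ext _ _ fun j => ?_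
    rw [Category.assoc, biproduct.lift_π, Category.id_comp]
    induction j using Fin.lastCases with
    | last => rw [Fin.lastCases_last, prodLift_snd]
    | cast i => rw [Fin.lastCases_castSucc, ← Category.assoc, prodLift_fst, biproduct.lift_π]
  · refine prod_hom_ext ?_ ?_
    · rw [Category.assoc, prodLift_fst, Category.id_comp]
      refine biproduct.hom_ext _ _ fun i => ?_
      rw [Category.assoc, biproduct.lift_π, biproduct.lift_π, Fin.lastCases_castSucc]
    · rw [Category.assoc, prodLift_snd, Category.id_comp, biproduct.lift_π, Fin.lastCases_last]

/-- `⨁_{i ≤ n+1} Bᵢ` is isogenous (indeed isomorphic) to `(⨁_{i ≤ n} Bᵢ) × B_{n+1}`. [cite: MumfordAV1970, §19] -/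
theorem isIsogenous_biproduct_fin_succ {n : ℕ} (B : Fin (n + 2) → AbelianVariety K) :
    IsIsogenous (⨁ B) ((⨁ fun i : Fin (n + 1) => B i.castSucc).prod (B (Fin.last (n + 1)))) := by
  obtain ⟨e⟩ := nonempty_iso_biproduct_fin_succ B
  exact ⟨e.hom, isIsogeny_hom_of_iso e⟩

/-- `⨁_{Fin 1} B` is isogenous (indeed isomorphic) to `B₀`. [cite: MumfordAV1970, §19] -/
theorem isIsogenous_biproduct_fin_one (B : Fin 1 → AbelianVariety K) : IsIsogenous (⨁ B) (B 0) := by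
  obtain ⟨e⟩ := nonempty_iso_biproduct_fin_one B
  exact ⟨e.hom, isIsogeny_hom_of_iso e⟩

/-- Reindexing a finite biproduct along an equivalence of index types is an isogeny (an isomorphism,
Mathlib's `biproduct.reindex`). [cite: MumfordAV1970, §19] -/
theorem isIsogenous_biproduct_reindex {ι κ : Type} [Fintype ι] [Fintype κ] [DecidableEq ι] [DecidableEq κ]
    (ε : κ ≃ ι) (B : ι → AbelianVariety K) : IsIsogenous (⨁ (B ∘ ε)) (⨁ B) :=
  ⟨(biproduct.reindex ε B).hom, isIsogeny_hom_of_iso _⟩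

end AbelianVariety

end Literature.AlgebraicGeometry.Motives

namespace Literature.AlgebraicGeometry.HodgeTheory

open Literature.AlgebraicGeometry.Motives

/-- **`HasNoTypeIVFactor (⨁_{i ≤ n} Bᵢ) ↔ ∀ i, HasNoTypeIVFactor (Bᵢ)`** for a `Fin (n+1)`-indexed family (induction
on `n` through `⨁_{i ≤ n+1} Bᵢ ≅ (⨁_{i ≤ n} Bᵢ) × B_{n+1}` and `hasNoTypeIVFactor_prod_iff`).
[cite: MoonenZarhin1999LowDim, §1 and Thm. (3.2)] [cite: MumfordAV1970, §19 Cor. 2 (p. 174)] -/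
theorem hasNoTypeIVFactor_biproduct_iff : ∀ (n : ℕ) (B : Fin (n + 1) → AbelianVariety ℂ),
    HasNoTypeIVFactor (⨁ B) ↔ ∀ i, HasNoTypeIVFactor (B i)
  | 0, B => by
    haveI : Subsingleton (Fin (0 + 1)) := inferInstanceAs (Subsingleton (Fin 1))
    rw [hasNoTypeIVFactor_iff_of_isIsogenous (AbelianVariety.isIsogenous_biproduct_fin_one B)]
    exact ⟨fun h i => by rwa [Subsingleton.elim i 0], fun h => h 0⟩
  | n + 1, B => by
    rw [hasNoTypeIVFactor_iff_of_isIsogenous_prod (AbelianVariety.isIsogenous_biproduct_fin_succ B),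
      hasNoTypeIVFactor_biproduct_iff n (fun i : Fin (n + 1) => B i.castSucc)]
    constructor
    · rintro ⟨h, hlast⟩ i
      induction i using Fin.lastCases with
      | last => exact hlast
      | cast i => exact h i
    · intro h
      exact ⟨fun i => h _, h _⟩

/-- The `Fintype`-indexed form: for a non-empty finite index type, `HasNoTypeIVFactor (⨁ᵢ Bᵢ) ↔ ∀ i, HasNoTypeIVFactor (Bᵢ)`.
[cite: MoonenZarhin1999LowDim, §1 and Thm. (3.2)] [cite: MumfordAV1970, §19 Cor. 2 (p. 174)] -/
theorem hasNoTypeIVFactor_biproduct_iff_of_nonempty {ι : Type} [Fintype ι] [DecidableEq ι] [Nonempty ι]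
    (B : ι → AbelianVariety ℂ) : HasNoTypeIVFactor (⨁ B) ↔ ∀ i, HasNoTypeIVFactor (B i) := by
  obtain ⟨n, hn⟩ : ∃ n : ℕ, Fintype.card ι = n + 1 := Nat.exists_eq_add_one_of_ne_zero Fintype.card_ne_zero
  have hε : Fin (n + 1) ≃ ι := ((Fintype.equivFin ι).trans (finCongr hn)).symm
  rw [← hasNoTypeIVFactor_iff_of_isIsogenous (AbelianVariety.isIsogenous_biproduct_reindex hε B),
    hasNoTypeIVFactor_biproduct_iff n (B ∘ hε)]
  exact ⟨fun h i => by simpa using h (hε.symm i), fun h i => h _⟩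

/-! ### §4 «No factor of type IV» is a condition on the simple factors -/

/-- **`HasNoTypeIVFactor X ↔ ∀ q, HasNoTypeIVFactor (B_q)` for `X ∼ ⨁_q ⨁_{Fin (n_q+1)} B_q`** — the shape of the
isotypic decomposition `AbelianVariety.exists_isIsogenous_biproduct_powers` (`B_q` simple, pairwise non-isogenous;
no such hypothesis is needed here). With `hasNoTypeIVFactor_iff_isTotallyReal_centerField`
(`NoTypeIVFactorIffCentreTotallyReal`, `B` simple: no type-IV factor ⟺ `Z(End⁰ B)` totally real ⟺ `B` of type
I–III) this is the printed notion «`X` has no simple factor of type IV». [cite: MoonenZarhin1999LowDim, §1 and Thm. (3.2)]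
[cite: MumfordAV1970, §19 Cor. 1 and Cor. 2 (p. 174)] -/
theorem hasNoTypeIVFactor_iff_forall_of_isIsogenous_biproduct_powers {X : AbelianVariety ℂ} {Q : Type} [Fintype Q]
    [DecidableEq Q] [Nonempty Q] (B : Q → AbelianVariety ℂ) (n : Q → ℕ)
    (hX : AbelianVariety.IsIsogenous X (⨁ fun q => ⨁ fun _ : Fin (n q + 1) => B q)) :
    HasNoTypeIVFactor X ↔ ∀ q, HasNoTypeIVFactor (B q) := by
  rw [hasNoTypeIVFactor_iff_of_isIsogenous hX, hasNoTypeIVFactor_biproduct_iff_of_nonempty]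
  refine forall_congr' fun q => ?_
  rw [hasNoTypeIVFactor_biproduct_iff (n q) (fun _ => B q)]
  exact ⟨fun h => h 0, fun h _ => h⟩

/-- The simple factors occurring in `X` have no type-IV factor when `X` has none: for `X ∼ ⨁_q ⨁ B_q` as above,
`HasNoTypeIVFactor X → HasNoTypeIVFactor (B q)` for every `q`. [cite: MoonenZarhin1999LowDim, §1 and Thm. (3.2)] -/
theorem HasNoTypeIVFactor.of_isIsogenous_biproduct_powers {X : AbelianVariety ℂ} {Q : Type} [Fintype Q]
    [DecidableEq Q] [Nonempty Q] {B : Q → AbelianVariety ℂ} {n : Q → ℕ} (h : HasNoTypeIVFactor X)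
    (hX : AbelianVariety.IsIsogenous X (⨁ fun q => ⨁ fun _ : Fin (n q + 1) => B q)) (q : Q) :
    HasNoTypeIVFactor (B q) :=
  (hasNoTypeIVFactor_iff_forall_of_isIsogenous_biproduct_powers B n hX).1 h q

end Literature.AlgebraicGeometry.HodgeTheory

end
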